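import Summits.KontsevichZagierPeriods.Zeta5Search.LaiSweepShard

/-!
# `κ₃` sweep certificate — shard file 062 of 127 (shards 434–440 of 889)

HONEST FRAMING. Systematic search; no irrationality claim unless certified. This file only checks,
by `decide +kernel`, shards 434–440 of the order-cell sweep of the `κ₃` point `(74, 2180, 444; δ74)`
(engine `LaiSweepEngine`, soundness `LaiSweepJump/Free/Eval/Shard/Kappa3`; a shard is `⟨regime, n,
p, q, p', q', Lo, Up⟩`: `n` cells from `p/q` to `p'/q'` with integer rate sums in `[Lo, Up]`, `K =
128`, `D = 2^40`). It draws NO conclusion: only the capstone `LaiKappa3SweepCert`, which needs all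
127 shard files, does. Kernel cost of this file ≈ 560 cells × 0.3 s.
-/

namespace Summit.KontsevichZagierPeriods.Zeta5Search.Sweep

set_option maxHeartbeats 100000000 in
/-- Shard 434: 80 cells of regime B from `89/208` to `85/198`.
[cite: Lai2024BallRivoal, §4 Lemma 4.3] -/
theorem shard434 :
    Shard.check 128 (2^40)
      ⟨true, 80, 89, 208, 85, 198, 18893663153039, 21862665791476⟩ = true := by
  decide +kernel

set_option maxHeartbeats 100000000 in
/-- Shard 435: 80 cells of regime B from `85/198` to `161/374`.
[cite: Lai2024BallRivoal, §4 Lemma 4.3] -/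
theorem shard435 :
    Shard.check 128 (2^40)
      ⟨true, 80, 85, 198, 161, 374, 15919529137558, 18435492892739⟩ = true := by
  decide +kernel

set_option maxHeartbeats 100000000 in
/-- Shard 436: 80 cells of regime B from `161/374` to `1037/2402`.
[cite: Lai2024BallRivoal, §4 Lemma 4.3] -/
theorem shard436 :
    Shard.check 128 (2^40)
      ⟨true, 80, 161, 374, 1037, 2402, 16616807282986, 19259090896559⟩ = true := by
  decide +kernel

set_option maxHeartbeats 100000000 in
/-- Shard 437: 80 cells of regime B from `1037/2402` to `520/1201`.
[cite: Lai2024BallRivoal, §4 Lemma 4.3] -/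
theorem shard437 :
    Shard.check 128 (2^40)
      ⟨true, 80, 1037, 2402, 520, 1201, 16659800463870, 19325511679997⟩ = true := by
  decide +kernel

set_option maxHeartbeats 100000000 in
/-- Shard 438: 80 cells of regime B from `520/1201` to `109/251`.
[cite: Lai2024BallRivoal, §4 Lemma 4.3] -/
theorem shard438 :
    Shard.check 128 (2^40)
      ⟨true, 80, 520, 1201, 109, 251, 17179486420471, 19945705481295⟩ = true := by
  decide +kernel

set_option maxHeartbeats 100000000 in
/-- Shard 439: 80 cells of regime B from `109/251` to `152/349`.
[cite: Lai2024BallRivoal, §4 Lemma 4.3] -/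
theorem shard439 :
    Shard.check 128 (2^40)
      ⟨true, 80, 109, 251, 152, 349, 16828066865830, 19554948896653⟩ = true := by
  decide +kernel

set_option maxHeartbeats 100000000 in
/-- Shard 440: 80 cells of regime B from `152/349` to `183/419`.
[cite: Lai2024BallRivoal, §4 Lemma 4.3] -/
theorem shard440 :
    Shard.check 128 (2^40)
      ⟨true, 80, 152, 349, 183, 419, 16213727523204, 18857110026228⟩ = true := by
  decide +kernel

/-- The checked shards of this file, in order. [folklore] -/
def shards062 : List (CheckedShard 128 (2^40)) :=
  [⟨_, shard434⟩, ⟨_, shard435⟩, ⟨_, shard436⟩, ⟨_, shard437⟩, ⟨_, shard438⟩,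
    ⟨_, shard439⟩, ⟨_, shard440⟩]

end Summit.KontsevichZagierPeriods.Zeta5Search.Sweep
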